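/-
Origin: expansion seat `prover-pub-hodgecm-mc-carch-1-g3-0`, handover #CA22 2026-08-20T06:55Z md5 182e52b712e4 (202 l., 14 decls; NEW additive leaf; imports installed #1101 Model.ArchSideOf only; RUN 43; drop-alone root of the Char chain; cert certs/ax-ArchSideOfChar-182e52b712e4.log: rc 0 / 60 s / 0 warnings / 14/14 trio) (`HOME/mc/pub-hodgecm-mc-carch-1/pkg43/HodgeCM/Model/ArchSideOfChar.lean`, md5 182e52b712e4, 202 lines);
landed by the gen-16 packager (p-g16) in gate run 43 as `HodgeCM/Model/ArchSideOfChar.lean` (verbatim).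
-/
/-
Copyright (c) 2026. Released under Apache 2.0 license as described in the file LICENSE.
Cell pub-hodgecm, MODEL layer (construction prover mc-carch-1, gen 3), (C-LINE1) RULING SUPPLEMENT 4 (R1): the S pin term GENERIC in its four
line characters, so that period-1's `archSideOf` (default η-split) and `archSideOfT` (R1, line-1 twist `ν`) are both instances BY `rfl`, and the
row-12 chain is re-cut ONCE over it.
-/
import Summits.HodgeConjecture.HodgeCM.Model.ArchSideOf_2

/-!
# The S pin term over four independent line characters: `archSideOfChar`

Period-1's LAYER B (`Model/ArchSideTerm`: `lineRepOf V S hGR hGR₀ hGR₁ hGR₂ hGR₃ η₀ η₁ η₂ η₃ k`) is generic in four line characters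
`η₀ η₁ η₂ η₃ : CMAdelic L (frameD V) × CMAdelicOne L →* ℂˣ`; only the TERM `archSideOf` (#1101, `Model/ArchSideOf` :310) fixes the default split
`etaₖ V S η` of ONE `η`.  This leaf is the term over the generic characters:

* `archSideOfChar V c hGR hGR₀ hGR₁ hGR₂ hGR₃ η₀ η₁ η₂ η₃ hmaj hrat A : ThetaAdelicSide V c` — `(P k).ω := lineRepOf … η₀ η₁ η₂ η₃ k` on the nose,
  the two Weil hypotheses as INPUTS `hmaj` ((W-maj⁺), per line) / `hrat` ((W-rat⁺), per line), everything else as in `archSideOf`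
  (`ΓU := Γ`, `ιinf := archInfOf V`, `Gfin := archFinOf V`, (L3b)/(L3) of `ArchSideLevel`); the seven `rfl` read-backs;
* **`archSideOf_eq_archSideOfChar`** (`rfl`): `archSideOf V c … η hη hηc h₁W A = archSideOfChar V c … (eta₀ V c.D η) (eta₁ …) (eta₂ …) (eta₃ …)
  (hasThetaMajorants_lineRepD … hηc h₁W) (lineRepD_mem_thetaStabilizerEnd … hη) A` — so sinst-1's `SA`/`SR`/`SROG` (all `= archSideOf …`) are
  instances, and period-1's R1 leaf `archSideOfT … η ν …` (`Model/ArchSideOfTwist`, STATUS l.12713) is the instance at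
  `(etaT₀ V c.D η ν, etaT₁ V c.D η ν, eta₂ V c.D η, eta₃ V c.D η)` by the same `rfl`;
* the binder-1 junctions over the generic term under the torus identities as hypotheses: `op_archSideOfChar (hη01)`,
  `seesaw34_archSideOfChar (hη23)`, `op34_archSideOfChar (hη23)` (LAYER B `op_lineRepOf` / `seesaw34_lineRepOf` / `op34_lineRepOf`).

Nothing is cited here and nothing is minted: a definition re-instantiating LAYER B and `rfl` lemmas; 0 records, 0 `def … : Prop`.
-/

set_option autoImplicit false

noncomputable section

open scoped Matrix SchwartzMap
open NumberField NumberField.mixedEmbedding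
open Literature.NumberTheory.Automorphic Literature.NumberTheory.Weil1964
open Literature.NumberTheory.GelbartRogawski1991.UnitaryDualPair
open HodgeCM.Adelic HodgeCM.PerL34
open Literature.Geometry.ComplexHyperbolic.BallModel (U21)

namespace HodgeCM.Model

namespace ArchSideTerm

section Term

variable {L : CMField} {ι₁ : L →+* ℂ} (V : HermSpace3 L ι₁) (c : SeesawCtx L)
  (hGR : (cmSplittingDatum (L : Type) finProdFinEquiv (frameD V) (frameD_real V) (frameD_ne V) (dW c.D) (dW_real c.D)
    (dW_ne c.D)).CompatibleSplitting)
  (hGR₀ : (cmSplittingDatum (L : Type) (e₁) (frameD V) (frameD_real V) (frameD_ne V) (lineVec (L : Type) (dW c.D 0))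
    (fun _ => dW_real c.D 0) (fun _ => dW_ne c.D 0)).CompatibleSplitting)
  (hGR₁ : (cmSplittingDatum (L : Type) (e₁) (frameD V) (frameD_real V) (frameD_ne V) (lineVec (L : Type) (dW c.D 1))
    (fun _ => dW_real c.D 1) (fun _ => dW_ne c.D 1)).CompatibleSplitting)
  (hGR₂ : (cmSplittingDatum (L : Type) (e₁) (frameD V) (frameD_real V) (frameD_ne V) (lineVec (L : Type) (dW' c.D 0))
    (fun _ => dW'_real c.D 0) (fun _ => dW'_ne c.D 0)).CompatibleSplitting)
  (hGR₃ : (cmSplittingDatum (L : Type) (e₁) (frameD V) (frameD_real V) (frameD_ne V) (lineVec (L : Type) (dW' c.D 1))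
    (fun _ => dW'_real c.D 1) (fun _ => dW'_ne c.D 1)).CompatibleSplitting)
  (η₀ η₁ η₂ η₃ : CMAdelic (L : Type) (frameD V) × CMAdelicOne (L : Type) →* ℂˣ)
  (hmaj : ∀ k : Fin 4, HasThetaMajorants fun (p : ↥(regimeSubgroup L V.Hm) × ↥(NumberField.relNormOneIdeles (↥(maximalRealSubfield L)) L))
      (φ : piSchwartzBruhat (↥(maximalRealSubfield L)) (Fin 3)) => lineRepOf V c.D hGR hGR₀ hGR₁ hGR₂ hGR₃ η₀ η₁ η₂ η₃ k p φ)
  (hrat : ∀ k : Fin 4, ∀ γ ∈ (V.latticeModel printFact_unitaryCompact_holds).Γ,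
      ∀ t ∈ NumberField.relNormOneRat (↥(maximalRealSubfield L)) L,
        lineRepOf V c.D hGR hGR₀ hGR₁ hGR₂ hGR₃ η₀ η₁ η₂ η₃ k (γ, t) ∈ thetaStabilizerEnd (↥(maximalRealSubfield L)) (Fin 3))
  (A : ∀ k : Fin 4, ArchLineInput V (lineRepOf V c.D hGR hGR₀ hGR₁ hGR₂ hGR₃ η₀ η₁ η₂ η₃ k))

/-- **THE S PIN TERM OVER FOUR LINE CHARACTERS** `archSideOfChar V c … η₀ η₁ η₂ η₃ hmaj hrat A : ThetaAdelicSide V c` — `(P k).ω := lineRepOf … k`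
on the nose, `(P k).ΓU := Γ`, `ιinf := archInfOf V`, `Gfin := archFinOf V`, (L3b)/(L3) of `ArchSideLevel`; the per-line Weil hypotheses
(W-maj⁺) `hmaj` / (W-rat⁺) `hrat` and the archimedean test data `A k` are input. -/
def archSideOfChar : ThetaAdelicSide V c where
  P k :=
    { ΓU := (V.latticeModel printFact_unitaryCompact_holds).Γ
      ω := lineRepOf V c.D hGR hGR₀ hGR₁ hGR₂ hGR₃ η₀ η₁ η₂ η₃ k
      Φinf := (A k).Φinf
      x₀ := (A k).x₀
      hx₀ := (A k).hx₀
      w := (A k).w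
      weight := (A k).weight
      majorants := hmaj k
      theta_rat := hrat k }
  hΓU _ := rfl
  ιinf := archInfOf V
  Gfin := archFinOf V
  comm_fin := commute_archFinOf_archInfOf V
  rat_split := rat_split_archInfOf V
  fin_mem_Gfin := inv_finAdelic_mem_archFinOf V
  rat_split_level := rat_split_level_archInfOf V

/-- (Ported verbatim from the HodgeCMPerL package; no docstring in the source.) -/
@[simp] theorem archSideOfChar_P_ω (k : Fin 4) :
    ((archSideOfChar V c hGR hGR₀ hGR₁ hGR₂ hGR₃ η₀ η₁ η₂ η₃ hmaj hrat A).P k).ω = lineRepOf V c.D hGR hGR₀ hGR₁ hGR₂ hGR₃ η₀ η₁ η₂ η₃ k :=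
  rfl

/-- (Ported verbatim from the HodgeCMPerL package; no docstring in the source.) -/
@[simp] theorem archSideOfChar_P_ΓU (k : Fin 4) :
    ((archSideOfChar V c hGR hGR₀ hGR₁ hGR₂ hGR₃ η₀ η₁ η₂ η₃ hmaj hrat A).P k).ΓU = (V.latticeModel printFact_unitaryCompact_holds).Γ := rfl

/-- (Ported verbatim from the HodgeCMPerL package; no docstring in the source.) -/
@[simp] theorem archSideOfChar_P_Φinf (k : Fin 4) :
    ((archSideOfChar V c hGR hGR₀ hGR₁ hGR₂ hGR₃ η₀ η₁ η₂ η₃ hmaj hrat A).P k).Φinf = (A k).Φinf := rfl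

/-- (Ported verbatim from the HodgeCMPerL package; no docstring in the source.) -/
@[simp] theorem archSideOfChar_P_x₀ (k : Fin 4) :
    ((archSideOfChar V c hGR hGR₀ hGR₁ hGR₂ hGR₃ η₀ η₁ η₂ η₃ hmaj hrat A).P k).x₀ = (A k).x₀ := rfl

/-- (Ported verbatim from the HodgeCMPerL package; no docstring in the source.) -/
@[simp] theorem archSideOfChar_P_w (k : Fin 4) :
    ((archSideOfChar V c hGR hGR₀ hGR₁ hGR₂ hGR₃ η₀ η₁ η₂ η₃ hmaj hrat A).P k).w = (A k).w := rfl

/-- (Ported verbatim from the HodgeCMPerL package; no docstring in the source.) -/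
@[simp] theorem archSideOfChar_ιinf : (archSideOfChar V c hGR hGR₀ hGR₁ hGR₂ hGR₃ η₀ η₁ η₂ η₃ hmaj hrat A).ιinf = archInfOf V := rfl

/-- (Ported verbatim from the HodgeCMPerL package; no docstring in the source.) -/
@[simp] theorem archSideOfChar_Gfin : (archSideOfChar V c hGR hGR₀ hGR₁ hGR₂ hGR₃ η₀ η₁ η₂ η₃ hmaj hrat A).Gfin = archFinOf V := rfl

/-- (L3b) AT THE TERM. -/
theorem regimeEquiv_prodSymm_one_mem_archSideOfChar_Gfin (hV : IsAnisotropic L V.Hm)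
    (kf : ↥(UnitaryGroup.finAdelic (↥(maximalRealSubfield L)) (L : Type) (IsCMField.complexConj L) 3 V.Hm)) :
    (Adelic.regimeEquiv L V.Hm hV ((UnitaryGroup.cmAdelicProdEquiv (L : Type) 3 V.Hm).symm (1, kf)) :
        (V.latticeModel printFact_unitaryCompact_holds).G) ∈
      (archSideOfChar V c hGR hGR₀ hGR₁ hGR₂ hGR₃ η₀ η₁ η₂ η₃ hmaj hrat A).Gfin :=
  regimeEquiv_prodSymm_one_mem_archFinOf V hV kf

/-- D-1′ `hι` AT THE TERM. -/
theorem archSideOfChar_ιinf_apply (hV : IsAnisotropic L V.Hm) (u : U21) :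
    (archSideOfChar V c hGR hGR₀ hGR₁ hGR₂ hGR₃ η₀ η₁ η₂ η₃ hmaj hrat A).ιinf u =
      Adelic.regimeEquiv L V.Hm hV
        (UnitaryGroup.archSectionU21CM (L : Type) ι₁ V.Hm V.sylvesterFrame (sylvesterFrame_J V) u) :=
  archInfOf_eq_regimeEquiv V hV u

/-- **`op`** of `SeesawCore.ofOp` for the generic term, under the torus identity `hη01` (LAYER B `op_lineRepOf`). -/
theorem op_archSideOfChar (η : CMAdelic (L : Type) (frameD V) × CMAdelic (L : Type) (dW c.D) →* ℂˣ)
    (hη01 : ∀ (v : CMAdelic (L : Type) (frameD V)) (u₀ u₁ : CMAdelicOne (L : Type)),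
      η (v, cmPlaneTorus (L : Type) (dW c.D) (u₀, u₁)) = η₀ (v, u₀) * η₁ (v, u₁))
    (g : ↥(regimeSubgroup L V.Hm)) (t : SeesawTorus (↥(maximalRealSubfield L)) L)
    (φ₁ φ₂ : piSchwartzBruhat (↥(maximalRealSubfield L)) (Fin 3)) :
    cmPairRepTwist (L : Type) finProdFinEquiv (frameD V) (frameD_real V) (frameD_ne V) (dW c.D) (dW_real c.D) (dW_ne c.D) hGR η
        ((cmFrameEquiv (L : Type) (frameG V) V.Hm (frameD V) (frame_congr V)) (g : ↥(HodgeCM.Adelic.adelicUnitaryGroup (L : Type) V.Hm)),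
          cmAdelicEquiv (L : Type) 2 (Matrix.diagonal (dW c.D)) (c.D.jT₁₂ t)) (tau12 V c.D φ₁ φ₂) =
      tau12 V c.D (((archSideOfChar V c hGR hGR₀ hGR₁ hGR₂ hGR₃ η₀ η₁ η₂ η₃ hmaj hrat A).P 0).ω (g, SeesawTorus.fst _ L t) φ₁)
        (((archSideOfChar V c hGR hGR₀ hGR₁ hGR₂ hGR₃ η₀ η₁ η₂ η₃ hmaj hrat A).P 1).ω (g, SeesawTorus.snd _ L t) φ₂) :=
  op_lineRepOf V c.D hGR hGR₀ hGR₁ hGR₂ hGR₃ η _ _ _ _ g t hη01 φ₁ φ₂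

/-- **`seesaw`** of `SeesawHyp34` for the generic term, under the torus identity `hη23` (LAYER B `seesaw34_lineRepOf`). -/
theorem seesaw34_archSideOfChar (η : CMAdelic (L : Type) (frameD V) × CMAdelic (L : Type) (dW c.D) →* ℂˣ)
    (hη23 : ∀ (v : CMAdelic (L : Type) (frameD V)) (u₀ u₁ : CMAdelicOne (L : Type)),
      η (v, cmConjPlaneTorus (L : Type) (dW c.D) (dW' c.D) c.D.isoGL (isoGL_hg₀ c.D) (u₀, u₁)) = η₂ (v, u₀) * η₃ (v, u₁))
    (g : ↥(regimeSubgroup L V.Hm)) (t : SeesawTorus (↥(maximalRealSubfield L)) L)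
    (φ₂ φ₃ : piSchwartzBruhat (↥(maximalRealSubfield L)) (Fin 3)) :
    thetaDistLM (↥(maximalRealSubfield L)) (Fin 6)
        (cmPairRepTwist (L : Type) finProdFinEquiv (frameD V) (frameD_real V) (frameD_ne V) (dW c.D) (dW_real c.D) (dW_ne c.D) hGR η
          ((cmFrameEquiv (L : Type) (frameG V) V.Hm (frameD V) (frame_congr V)) (g : ↥(HodgeCM.Adelic.adelicUnitaryGroup (L : Type) V.Hm)),
            cmAdelicEquiv (L : Type) 2 (Matrix.diagonal (dW c.D)) (c.D.jT₃₄ t)) (tau34 V c.D φ₂ φ₃)) =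
      thetaDistLM (↥(maximalRealSubfield L)) (Fin 3)
          (((archSideOfChar V c hGR hGR₀ hGR₁ hGR₂ hGR₃ η₀ η₁ η₂ η₃ hmaj hrat A).P 2).ω (g, SeesawTorus.fst _ L t) φ₂) *
        thetaDistLM (↥(maximalRealSubfield L)) (Fin 3)
          (((archSideOfChar V c hGR hGR₀ hGR₁ hGR₂ hGR₃ η₀ η₁ η₂ η₃ hmaj hrat A).P 3).ω (g, SeesawTorus.snd _ L t) φ₃) :=
  seesaw34_lineRepOf V c.D hGR hGR₀ hGR₁ hGR₂ hGR₃ η _ _ _ _ g t hη23 φ₂ φ₃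

/-- the operator-level version for lines `2,3` (LAYER B `op34_lineRepOf`). -/
theorem op34_archSideOfChar (η : CMAdelic (L : Type) (frameD V) × CMAdelic (L : Type) (dW c.D) →* ℂˣ)
    (hη23 : ∀ (v : CMAdelic (L : Type) (frameD V)) (u₀ u₁ : CMAdelicOne (L : Type)),
      η (v, cmConjPlaneTorus (L : Type) (dW c.D) (dW' c.D) c.D.isoGL (isoGL_hg₀ c.D) (u₀, u₁)) = η₂ (v, u₀) * η₃ (v, u₁))
    (g : ↥(regimeSubgroup L V.Hm)) (t : SeesawTorus (↥(maximalRealSubfield L)) L)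
    (φ₂ φ₃ : piSchwartzBruhat (↥(maximalRealSubfield L)) (Fin 3)) :
    cmPairRepTwist (L : Type) finProdFinEquiv (frameD V) (frameD_real V) (frameD_ne V) (dW c.D) (dW_real c.D) (dW_ne c.D) hGR η
        ((cmFrameEquiv (L : Type) (frameG V) V.Hm (frameD V) (frame_congr V)) (g : ↥(HodgeCM.Adelic.adelicUnitaryGroup (L : Type) V.Hm)),
          cmAdelicEquiv (L : Type) 2 (Matrix.diagonal (dW c.D)) (c.D.jT₃₄ t)) (tau34 V c.D φ₂ φ₃) =
      tau34 V c.D (((archSideOfChar V c hGR hGR₀ hGR₁ hGR₂ hGR₃ η₀ η₁ η₂ η₃ hmaj hrat A).P 2).ω (g, SeesawTorus.fst _ L t) φ₂)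
        (((archSideOfChar V c hGR hGR₀ hGR₁ hGR₂ hGR₃ η₀ η₁ η₂ η₃ hmaj hrat A).P 3).ω (g, SeesawTorus.snd _ L t) φ₃) :=
  op34_lineRepOf V c.D hGR hGR₀ hGR₁ hGR₂ hGR₃ η _ _ _ _ g t hη23 φ₂ φ₃

end Term

/-! ## The default split is an instance, by `rfl` -/

section Default

variable {L : CMField} {ι₁ : L →+* ℂ} (V : HermSpace3 L ι₁) (c : SeesawCtx L)
  (hGR : (cmSplittingDatum (L : Type) finProdFinEquiv (frameD V) (frameD_real V) (frameD_ne V) (dW c.D) (dW_real c.D)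
    (dW_ne c.D)).CompatibleSplitting)
  (hGR₀ : (cmSplittingDatum (L : Type) (e₁) (frameD V) (frameD_real V) (frameD_ne V) (lineVec (L : Type) (dW c.D 0))
    (fun _ => dW_real c.D 0) (fun _ => dW_ne c.D 0)).CompatibleSplitting)
  (hGR₁ : (cmSplittingDatum (L : Type) (e₁) (frameD V) (frameD_real V) (frameD_ne V) (lineVec (L : Type) (dW c.D 1))
    (fun _ => dW_real c.D 1) (fun _ => dW_ne c.D 1)).CompatibleSplitting)
  (hGR₂ : (cmSplittingDatum (L : Type) (e₁) (frameD V) (frameD_real V) (frameD_ne V) (lineVec (L : Type) (dW' c.D 0))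
    (fun _ => dW'_real c.D 0) (fun _ => dW'_ne c.D 0)).CompatibleSplitting)
  (hGR₃ : (cmSplittingDatum (L : Type) (e₁) (frameD V) (frameD_real V) (frameD_ne V) (lineVec (L : Type) (dW' c.D 1))
    (fun _ => dW'_real c.D 1) (fun _ => dW'_ne c.D 1)).CompatibleSplitting)
  (η : CMAdelic (L : Type) (frameD V) × CMAdelic (L : Type) (dW c.D) →* ℂˣ)
  (hη : ∀ γU ∈ CMRat (L : Type) (frameD V), ∀ γ ∈ CMRat (L : Type) (dW c.D), η (γU, γ) = 1)
  (hηc : Continuous fun p => ((η p : ℂˣ) : ℂ))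
  (h₁W : (∀ j, 0 < (ι₁ (dW c.D j)).re) ∨ ∀ j, (ι₁ (dW c.D j)).re < 0)
  (A : ∀ k : Fin 4, ArchLineInput V (lineRepD V c.D hGR hGR₀ hGR₁ hGR₂ hGR₃ η k))

/-- **period-1's `archSideOf` IS `archSideOfChar` at the default split** `(eta₀, eta₁, eta₂, eta₃) V c.D η`, with its two PROVED Weil
hypotheses (`hasThetaMajorants_lineRepD`, `lineRepD_mem_thetaStabilizerEnd`) — `rfl`. -/
theorem archSideOf_eq_archSideOfChar :
    archSideOf V c hGR hGR₀ hGR₁ hGR₂ hGR₃ η hη hηc h₁W A =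
      archSideOfChar V c hGR hGR₀ hGR₁ hGR₂ hGR₃ (eta₀ V c.D η) (eta₁ V c.D η) (eta₂ V c.D η) (eta₃ V c.D η)
        (hasThetaMajorants_lineRepD V c.D hGR hGR₀ hGR₁ hGR₂ hGR₃ η hηc h₁W)
        (lineRepD_mem_thetaStabilizerEnd V c.D hGR hGR₀ hGR₁ hGR₂ hGR₃ η hη) A :=
  rfl

end Default

end ArchSideTerm

end HodgeCM.Model

end
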